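/-
Copyright (c) 2026 the pub-hodgecm-mathlib formalisation cell (harness21).  Prover seat hodgecm-mathlib-K2E4-p11 (g9): Track B «K2-LIT»,
hLiu418 = stmt-HodgeConjecture-24832, socket #41 KIND W, organ «Φ6b-ind» (R3) growth, FILE G3∕G4 (KW desk F0P2-p08 (g4) 01:31:06Z «(R3) three hands»;
frozen bytes 01:47:30Z for K2E4-p10 (g10)'s (G5)): DECAY OF THE TRACE MOMENTS OF SHIMURA's ξ IN THE WHOLE INDEX `h`, UNIFORMLY ON THE SIGNATURE CLASS
AND LOCALLY UNIFORMLY IN THE PARAMETER.  THEOREMS ONLY (no `def`, no `instance`, no `notation`, no named-fact hypothesis, no `sorry`).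
-/
import Summits.HodgeConjecture.HodgeConjecture.Theorems.K2LiuHermTwoXiMomentStripDecay        -- ★ G2 (this seat): decay in `h₀₀`
import Summits.HodgeConjecture.HodgeConjecture.Theorems.K2LiuArchWhittakerLeviEquivariance    -- ★ `integral_comp_hermTwo_conj`
import Mathlib.Analysis.Matrix.Spectrum
import Mathlib.Analysis.CStarAlgebra.Matrix
import HarnessLib

/-!
# Crux `HLiu418`, ROAD Φ ∕ KIND W organ «Φ6b-ind», (R3) FILE G3∕G4: decay of the trace moments of ξ in the index, uniform on the signature class

Cell `hodgecm-mathlib`, crux item hLiu418 = `stmt-HodgeConjecture-24832` (helper lane `--supports … --as helper`, count-neutral), route of record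
`HCCMUnconditional`; squad K2 ∕ K2Liu, road `K2_Liu`, socket #41, KIND W.

WHAT.  `M_e(h; Θ; α, β) = ∫ (−2πi·tr(Θx))^e·ξ-integrand(1, h; α, β)(x) dx`.
* §1 UNITARY COVARIANCE `traceMoment_conj`: `M_e(h; Θ) = M_e(UᴴhU; UᴴΘU)` for unitary `U` (substitution `x ↦ UxUᴴ`, ★ `integral_comp_hermTwo_conj`, `|det U| = 1`),
  with the entry bookkeeping `sum_norm_conj_le` (`Σ|(UᴴΘU)_jk| ≤ 4Σ|Θ_jk|`).
* §2 SPECTRAL REDUCTION: Mathlib's `Matrix.IsHermitian.conjStarAlgAut_star_eigenvectorUnitary` diagonalises `h`; ★ G2 at the diagonal index (and at its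
  transpose by the flip `P = (0 1; 1 0)`) gives decay in `|λ₀|` AND in `|λ₁|`, hence (geometric mean) in `|λ₀| + |λ₁| ≥ ¼·Σ|h_ij|` (`sum_norm_le_of_spectral`).
* §3 **`traceMoment_decay`** (the FROZEN (G4) BYTES consumed by (G5) `K2LiuHermTwoXiJetContinuationGrowth`):
  `∀ e a b z, 3 + e < re(a+b+2z) → ∃ C c r, 0 ≤ C ∧ 0 < c ∧ 0 < r ∧ ∀ h, hᴴ = h → h.det.re < 0 → ∀ s, dist s z < r →`
  `‖∫ (−2πi·tr(Θx))^e·ξ-integrand(1, h; a+s, b+s)(x) dx‖ ≤ C·exp(−c·Σ_ij ‖h i j‖)` with `c = π∕16` (the `det` binder is idle: every hermitian `h` works).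
[Shimura1982, §4] (decay of the confluent hypergeometric functions in the index; here by the ξ-side contour shift of ★ G2).
HONEST LABEL.  Count-neutral helper of the K2_Liu road; it pays no socket by itself: `HC_CM` is proved only modulo the 7 printed citations
(2 remaining named inputs: hLiu418 = `stmt-HodgeConjecture-24832`, h413 = `stmt-HodgeConjecture-24833`) until rung 0 closes.

## References
* [Shimura1982] G. Shimura, *Confluent hypergeometric functions on tube domains*, Math. Ann. 260 (1982) 269–302: §4.
* [Shimura1997] G. Shimura, *Euler Products and Eisenstein Series*, CBMS 93 (1997): §16.4.
-/

set_option autoImplicit false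
-- the mandated namespace repeats the single-problem summit's segment (`HodgeConjecture.HodgeConjecture`)
set_option linter.dupNamespace false

noncomputable section

open scoped Matrix ComplexConjugate ComplexOrder
open Complex Matrix MeasureTheory

namespace Summit.HodgeConjecture.HodgeConjecture.Cruxes.HLiu418.K2LiuHermTwoXiMomentDecay

open Summit.HodgeConjecture.HodgeConjecture.Cruxes.HLiu418.K2LiuHermTwoGammaDefs
open Summit.HodgeConjecture.HodgeConjecture.Cruxes.HLiu418.K2LiuHermTwoConfluentXiDefs
open Summit.HodgeConjecture.HodgeConjecture.Cruxes.HLiu418.K2LiuHermTwoDetPowerIntegrable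
open Summit.HodgeConjecture.HodgeConjecture.Cruxes.HLiu418.K2LiuArchWhittakerLeviEquivariance (integral_comp_hermTwo_conj)
open Summit.HodgeConjecture.HodgeConjecture.Cruxes.HLiu418.K2LiuHermTwoXiStripBounds (mul_le_norm_det_diag)
open Summit.HodgeConjecture.HodgeConjecture.Cruxes.HLiu418.K2LiuHermTwoXiMomentStripDecay

/-! ## §1 Unitary covariance of the trace moments -/

/-- `|det U| = 1` when `UᴴU = 1`. [folklore] -/
theorem norm_det_eq_one_of_conjTranspose_mul {U : Matrix (Fin 2) (Fin 2) ℂ} (hU : Uᴴ * U = 1) : ‖U.det‖ = 1 := by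
  have h := congrArg Matrix.det hU
  rw [det_mul, det_conjTranspose, det_one] at h
  have h2 : ‖U.det‖ * ‖U.det‖ = 1 := by
    have := congrArg (fun w : ℂ => ‖w‖) h
    simpa only [norm_mul, norm_star, norm_one] using this
  rcases mul_self_eq_one_iff.mp h2 with h3 | h3
  · exact h3
  · linarith [norm_nonneg U.det]

/-- THE INTEGRAND UNDER A UNITARY SUBSTITUTION `x ↦ UxUᴴ`: the traces move to `UᴴΘU`, `UᴴhU`, the determinants `det(1 ∓ ix)` are invariant. [folklore] -/
theorem integrand_conj {U : Matrix (Fin 2) (Fin 2) ℂ} (hU : U * Uᴴ = 1) (h Θ : Matrix (Fin 2) (Fin 2) ℂ) (α β : ℂ) (e : ℕ)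
    (X : Matrix (Fin 2) (Fin 2) ℂ) :
    (-(2 * Real.pi * I) * (Θ * (U * X * Uᴴ)).trace) ^ e *
        (cexp (-(2 * Real.pi * I) * (h * (U * X * Uᴴ)).trace) *
          ((cexp (-(Real.pi * I) * α) * ((1 : Matrix (Fin 2) (Fin 2) ℂ) - I • (U * X * Uᴴ)).det ^ (-α)) *
            (cexp ((Real.pi * I) * β) * ((1 : Matrix (Fin 2) (Fin 2) ℂ) + I • (U * X * Uᴴ)).det ^ (-β)))) =
      (-(2 * Real.pi * I) * (Uᴴ * Θ * U * X).trace) ^ e *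
        (cexp (-(2 * Real.pi * I) * (Uᴴ * h * U * X).trace) *
          ((cexp (-(Real.pi * I) * α) * ((1 : Matrix (Fin 2) (Fin 2) ℂ) - I • X).det ^ (-α)) *
            (cexp ((Real.pi * I) * β) * ((1 : Matrix (Fin 2) (Fin 2) ℂ) + I • X).det ^ (-β)))) := by
  have hdd : U.det * Uᴴ.det = 1 := by rw [← det_mul, hU, det_one]
  have htr : ∀ A : Matrix (Fin 2) (Fin 2) ℂ, (A * (U * X * Uᴴ)).trace = (Uᴴ * A * U * X).trace := by
    intro A
    rw [show A * (U * X * Uᴴ) = (A * U * X) * Uᴴ by simp only [Matrix.mul_assoc], Matrix.trace_mul_comm]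
    simp only [Matrix.mul_assoc]
  have hsub : (1 : Matrix (Fin 2) (Fin 2) ℂ) - I • (U * X * Uᴴ) = U * ((1 : Matrix (Fin 2) (Fin 2) ℂ) - I • X) * Uᴴ := by
    rw [Matrix.mul_sub, Matrix.sub_mul, Matrix.mul_one, hU, Matrix.mul_smul, Matrix.smul_mul]
  have hadd : (1 : Matrix (Fin 2) (Fin 2) ℂ) + I • (U * X * Uᴴ) = U * ((1 : Matrix (Fin 2) (Fin 2) ℂ) + I • X) * Uᴴ := by
    rw [Matrix.mul_add, Matrix.add_mul, Matrix.mul_one, hU, Matrix.mul_smul, Matrix.smul_mul]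
  have hdet1 : ((1 : Matrix (Fin 2) (Fin 2) ℂ) - I • (U * X * Uᴴ)).det = ((1 : Matrix (Fin 2) (Fin 2) ℂ) - I • X).det := by
    rw [hsub, det_mul, det_mul, mul_comm U.det, mul_assoc, hdd, mul_one]
  have hdet2 : ((1 : Matrix (Fin 2) (Fin 2) ℂ) + I • (U * X * Uᴴ)).det = ((1 : Matrix (Fin 2) (Fin 2) ℂ) + I • X).det := by
    rw [hadd, det_mul, det_mul, mul_comm U.det, mul_assoc, hdd, mul_one]
  rw [htr Θ, htr h, hdet1, hdet2]

/-- **UNITARY COVARIANCE OF THE TRACE MOMENTS**: `M_e(h; Θ; α, β) = M_e(UᴴhU; UᴴΘU; α, β)` for unitary `U` (substitution `x ↦ UxUᴴ`, ★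
`integral_comp_hermTwo_conj`, `|det U| = 1`). [folklore] -/
theorem traceMoment_conj {U : Matrix (Fin 2) (Fin 2) ℂ} (hU : U * Uᴴ = 1) (hU' : Uᴴ * U = 1) (h Θ : Matrix (Fin 2) (Fin 2) ℂ) (α β : ℂ) (e : ℕ) :
    ∫ c : ℝ × ℂ × ℝ, (-(2 * Real.pi * I) * (Θ * hermTwo c).trace) ^ e * xiTwoIntegrand 1 h α β c =
      ∫ c : ℝ × ℂ × ℝ, (-(2 * Real.pi * I) * ((Uᴴ * Θ * U) * hermTwo c).trace) ^ e * xiTwoIntegrand 1 (Uᴴ * h * U) α β c := by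
  have hdetU : U.det ≠ 0 := by
    have := norm_det_eq_one_of_conjTranspose_mul hU'
    intro h0; rw [h0, norm_zero] at this; exact zero_ne_one this
  set G : Matrix (Fin 2) (Fin 2) ℂ → ℂ := fun X =>
    (-(2 * Real.pi * I) * (Θ * X).trace) ^ e *
      (cexp (-(2 * Real.pi * I) * (h * X).trace) *
        ((cexp (-(Real.pi * I) * α) * ((1 : Matrix (Fin 2) (Fin 2) ℂ) - I • X).det ^ (-α)) *
          (cexp ((Real.pi * I) * β) * ((1 : Matrix (Fin 2) (Fin 2) ℂ) + I • X).det ^ (-β)))) with hG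
  have hL : (fun c : ℝ × ℂ × ℝ => (-(2 * Real.pi * I) * (Θ * hermTwo c).trace) ^ e * xiTwoIntegrand 1 h α β c) = fun c => G (hermTwo c) := by
    funext c; simp only [hG, xiTwoIntegrand_apply]
  have hR : (fun c : ℝ × ℂ × ℝ => (-(2 * Real.pi * I) * ((Uᴴ * Θ * U) * hermTwo c).trace) ^ e * xiTwoIntegrand 1 (Uᴴ * h * U) α β c) =
      fun c => G (U * hermTwo c * Uᴴ) := by
    funext c; simp only [hG, xiTwoIntegrand_apply]; exact (integrand_conj hU h Θ α β e (hermTwo c)).symm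
  rw [hL, hR, integral_comp_hermTwo_conj hdetU G, norm_det_eq_one_of_conjTranspose_mul hU', one_pow, one_smul]

/-- Entries of a conjugate `UᴴΘU` by a matrix with entries of norm `≤ 1`: `Σ_ij |(UᴴΘU)_ij| ≤ 4·Σ_kl |Θ_kl|`. [folklore] -/
theorem sum_norm_conj_le {U : Matrix (Fin 2) (Fin 2) ℂ} (hU : ∀ i j, ‖U i j‖ ≤ 1) (Θ : Matrix (Fin 2) (Fin 2) ℂ) :
    ‖(Uᴴ * Θ * U) 0 0‖ + ‖(Uᴴ * Θ * U) 0 1‖ + ‖(Uᴴ * Θ * U) 1 0‖ + ‖(Uᴴ * Θ * U) 1 1‖ ≤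
      4 * (‖Θ 0 0‖ + ‖Θ 0 1‖ + ‖Θ 1 0‖ + ‖Θ 1 1‖) := by
  have key : ∀ i j, ‖(Uᴴ * Θ * U) i j‖ ≤ ‖Θ 0 0‖ + ‖Θ 0 1‖ + ‖Θ 1 0‖ + ‖Θ 1 1‖ := by
    intro i j
    have hent : ∀ k l, ‖star (U k i) * Θ k l * U l j‖ ≤ ‖Θ k l‖ := by
      intro k l
      rw [norm_mul, norm_mul, norm_star]
      have h1 := hU k i
      have h2 := hU l j
      have h3 : 0 ≤ ‖Θ k l‖ := norm_nonneg _
      calc ‖U k i‖ * ‖Θ k l‖ * ‖U l j‖ ≤ 1 * ‖Θ k l‖ * 1 := by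
            gcongr
        _ = ‖Θ k l‖ := by ring
    have hexp : (Uᴴ * Θ * U) i j = star (U 0 i) * Θ 0 0 * U 0 j + star (U 0 i) * Θ 0 1 * U 1 j +
        (star (U 1 i) * Θ 1 0 * U 0 j + star (U 1 i) * Θ 1 1 * U 1 j) := by
      simp only [Matrix.mul_apply, Matrix.conjTranspose_apply, Fin.sum_univ_two]
      ring
    rw [hexp]
    calc _ ≤ ‖star (U 0 i) * Θ 0 0 * U 0 j + star (U 0 i) * Θ 0 1 * U 1 j‖ + ‖star (U 1 i) * Θ 1 0 * U 0 j + star (U 1 i) * Θ 1 1 * U 1 j‖ :=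
          norm_add_le _ _
      _ ≤ (‖star (U 0 i) * Θ 0 0 * U 0 j‖ + ‖star (U 0 i) * Θ 0 1 * U 1 j‖) + (‖star (U 1 i) * Θ 1 0 * U 0 j‖ + ‖star (U 1 i) * Θ 1 1 * U 1 j‖) :=
          add_le_add (norm_add_le _ _) (norm_add_le _ _)
      _ ≤ (‖Θ 0 0‖ + ‖Θ 0 1‖) + (‖Θ 1 0‖ + ‖Θ 1 1‖) := add_le_add (add_le_add (hent 0 0) (hent 0 1)) (add_le_add (hent 1 0) (hent 1 1))
      _ = _ := by ring
  linarith [key 0 0, key 0 1, key 1 0, key 1 1]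

/-! ## §2 Spectral reduction: decay in both eigenvalues, and the entry sum against the eigenvalues -/

/-- THE FLIP `P = (0 1; 1 0)` conjugates `diag(d₀, d₁)` to a matrix with `(0,0)` entry `d₁`; `PPᴴ = PᴴP = 1`; its entries have norm `≤ 1`. [folklore] -/
theorem flip_letters :
    (!![(0 : ℂ), 1; 1, 0] : Matrix (Fin 2) (Fin 2) ℂ) * (!![(0 : ℂ), 1; 1, 0] : Matrix (Fin 2) (Fin 2) ℂ)ᴴ = 1 ∧
    (!![(0 : ℂ), 1; 1, 0] : Matrix (Fin 2) (Fin 2) ℂ)ᴴ * (!![(0 : ℂ), 1; 1, 0] : Matrix (Fin 2) (Fin 2) ℂ) = 1 ∧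
    (∀ i j, ‖(!![(0 : ℂ), 1; 1, 0] : Matrix (Fin 2) (Fin 2) ℂ) i j‖ ≤ 1) ∧
    ∀ d : Fin 2 → ℂ, ((!![(0 : ℂ), 1; 1, 0] : Matrix (Fin 2) (Fin 2) ℂ)ᴴ * diagonal d * !![(0 : ℂ), 1; 1, 0]) 0 0 = d 1 := by
  refine ⟨?_, ?_, ?_, ?_⟩
  · ext i j; fin_cases i <;> fin_cases j <;> simp [Matrix.mul_apply, Fin.sum_univ_two, Matrix.conjTranspose_apply]
  · ext i j; fin_cases i <;> fin_cases j <;> simp [Matrix.mul_apply, Fin.sum_univ_two, Matrix.conjTranspose_apply]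
  · intro i j; fin_cases i <;> fin_cases j <;> simp
  · intro d; simp [Matrix.mul_apply, Fin.sum_univ_two, Matrix.conjTranspose_apply, Matrix.diagonal]

/-- **THE ENTRY SUM AGAINST THE EIGENVALUES**: for hermitian `h` with unitary diagonalisation `h = U·diag(λ)·Uᴴ` (`|U_ij| ≤ 1`),
`Σ_ij |h_ij| ≤ 4(|λ₀| + |λ₁|)`. [folklore] -/
theorem sum_norm_le_of_spectral {h U : Matrix (Fin 2) (Fin 2) ℂ} {d : Fin 2 → ℝ} (hU : ∀ i j, ‖U i j‖ ≤ 1)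
    (hsp : h = U * diagonal (fun i => ((d i : ℝ) : ℂ)) * Uᴴ) :
    ∑ i, ∑ j, ‖h i j‖ ≤ 4 * (|d 0| + |d 1|) := by
  have key : ∀ i j, ‖h i j‖ ≤ |d 0| + |d 1| := by
    intro i j
    have hexp : h i j = U i 0 * (d 0 : ℂ) * star (U j 0) + U i 1 * (d 1 : ℂ) * star (U j 1) := by
      rw [hsp]
      simp only [Matrix.mul_apply, Matrix.conjTranspose_apply, Fin.sum_univ_two, Matrix.diagonal_apply_eq,
        Matrix.diagonal_apply_ne _ (by decide : (0 : Fin 2) ≠ 1), Matrix.diagonal_apply_ne _ (by decide : (1 : Fin 2) ≠ 0),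
        mul_zero, add_zero, zero_add]
    have hent : ∀ k, ‖U i k * (d k : ℂ) * star (U j k)‖ ≤ |d k| := by
      intro k
      rw [norm_mul, norm_mul, norm_star, Complex.norm_real, Real.norm_eq_abs]
      have h1 := hU i k
      have h2 := hU j k
      have h3 : 0 ≤ |d k| := abs_nonneg _
      calc ‖U i k‖ * |d k| * ‖U j k‖ ≤ 1 * |d k| * 1 := by gcongr
        _ = |d k| := by ring
    rw [hexp]
    exact (norm_add_le _ _).trans (add_le_add (hent 0) (hent 1))
  simp only [Fin.sum_univ_two]
  linarith [key 0 0, key 0 1, key 1 0, key 1 1]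

/-! ## §3 The decay lemma (G4), frozen bytes -/

/-- **DECAY OF THE TRACE MOMENTS OF ξ IN THE INDEX, UNIFORM ON THE SIGNATURE CLASS AND LOCALLY UNIFORM IN THE PARAMETER** (organ «Φ6b-ind» (R3),
the frozen (G4) bytes consumed by (G5) `K2LiuHermTwoXiJetContinuationGrowth.hJet_holds_growth`): for every `Θ`, `e : ℕ`, base point `(a, b)` and centre `z`
with `re(a+b+2z) > 3 + e` there are `C ≥ 0`, `c = π∕16 > 0`, `r > 0` such that for EVERY hermitian `h` (the `det` binder is idle) and every `s` with
`dist s z < r`, `‖∫ (−2πi·tr(Θx))^e·ξ-integrand(1, h; a+s, b+s)(x) dx‖ ≤ C·exp(−c·Σ_ij ‖h i j‖)`.  Road: ★ G2 (decay in `|re h₀₀|`) at the unitary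
conjugates `UᴴhU = diag(λ₀, λ₁)` and `(UP)ᴴh(UP)` (§1 covariance, Mathlib's spectral theorem, the flip `P`), geometric mean, `Σ|h_ij| ≤ 4(|λ₀|+|λ₁|)`, and
the sup of ★ G2's constant over the `s`-ball. [cite: Shimura1982, §4] -/
theorem traceMoment_decay (Θ : Matrix (Fin 2) (Fin 2) ℂ) :
    ∀ (e : ℕ) (a b z : ℂ), 3 + (e : ℝ) < (a + b + 2 * z).re →
      ∃ C c r : ℝ, 0 ≤ C ∧ 0 < c ∧ 0 < r ∧ ∀ h : Matrix (Fin 2) (Fin 2) ℂ, hᴴ = h → h.det.re < 0 →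
        ∀ s : ℂ, dist s z < r →
          ‖∫ x : ℝ × ℂ × ℝ, (-(2 * Real.pi * I) * (Θ * hermTwo x).trace) ^ e * xiTwoIntegrand 1 h (a + s) (b + s) x‖ ≤
            C * Real.exp (-(c * ∑ i, ∑ j, ‖h i j‖)) := by
  intro e a b z hz
  -- the ball and the constants
  set σz : ℝ := (a + b + 2 * z).re - e with hσz
  have hσz3 : 3 < σz := by rw [hσz]; linarith
  set r : ℝ := (σz - 3) / 4 with hr
  have hr0 : 0 < r := by rw [hr]; linarith
  set SΘ : ℝ := ‖Θ 0 0‖ + ‖Θ 0 1‖ + ‖Θ 1 0‖ + ‖Θ 1 1‖ with hSΘ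
  set A₁ : ℝ := |(a + z).re| + r with hA₁
  set A₂ : ℝ := |(a + z).im| + |(b + z).im| + 2 * r with hA₂
  have hσI : 3 < σz - 2 * r := by rw [hr]; linarith
  set Iσ : ℝ := ∫ c : ℝ × ℂ × ℝ, ‖((1 : Matrix (Fin 2) (Fin 2) ℂ) + I • hermTwo c).det‖ ^ (-(σz - 2 * r)) with hIσ
  have hIσ0 : 0 ≤ Iσ := integral_nonneg fun c => Real.rpow_nonneg (norm_nonneg _) _
  set C : ℝ := (20 * Real.pi * (4 * SΘ)) ^ e * (9 : ℝ) ^ A₁ * Real.exp (2 * Real.pi * A₂) * ((9 : ℝ) ^ (σz + 2 * r) * Iσ) with hC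
  have hC0 : 0 ≤ C := by positivity
  refine ⟨C, Real.pi / 16, r, hC0, by positivity, hr0, fun h hh _ s hs => ?_⟩
  have hh' : h.IsHermitian := hh
  -- the parameters on the ball
  have hsz : ‖s - z‖ < r := by rwa [← Complex.dist_eq]
  have hre := Complex.abs_re_le_norm (s - z)
  have him := Complex.abs_im_le_norm (s - z)
  have hre' := abs_le.mp (hre.trans hsz.le)
  have him' := abs_le.mp (him.trans hsz.le)
  have hσs : (a + s + (b + s)).re - e = σz + 2 * (s - z).re := by
    rw [hσz]; simp only [add_re, sub_re, mul_re, re_ofNat, im_ofNat]; ring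
  have hαβ : 3 + (e : ℝ) < (a + s + (b + s)).re := by linarith
  have hσlo : σz - 2 * r ≤ (a + s + (b + s)).re - e := by linarith
  have hσhi : (a + s + (b + s)).re - e ≤ σz + 2 * r := by linarith
  have hαre : |(a + s).re| ≤ A₁ := by
    have e1 : (a + s).re = (a + z).re + (s - z).re := by simp only [add_re, sub_re]; ring
    rw [e1, hA₁]
    exact (abs_add_le _ _).trans (by linarith [hre.trans hsz.le])
  have hαim : |(a + s).im| + |(b + s).im| ≤ A₂ := by
    have e1 : (a + s).im = (a + z).im + (s - z).im := by simp only [add_im, sub_im]; ring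
    have e2 : (b + s).im = (b + z).im + (s - z).im := by simp only [add_im, sub_im]; ring
    rw [e1, e2, hA₂]
    linarith [abs_add_le (a + z).im (s - z).im, abs_add_le (b + z).im (s - z).im, him.trans hsz.le]
  -- the spectral data of `h`
  obtain ⟨U, hUdef⟩ : ∃ U : Matrix (Fin 2) (Fin 2) ℂ, (hh'.eigenvectorUnitary : Matrix (Fin 2) (Fin 2) ℂ) = U := ⟨_, rfl⟩
  obtain ⟨d, hddef⟩ : ∃ d : Fin 2 → ℝ, hh'.eigenvalues = d := ⟨_, rfl⟩
  have hcomp : (RCLike.ofReal ∘ d : Fin 2 → ℂ) = fun i => ((d i : ℝ) : ℂ) := rfl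
  have hUU : U * Uᴴ = 1 := by
    have := Unitary.coe_mul_star_self hh'.eigenvectorUnitary
    rw [Unitary.coe_star, Matrix.star_eq_conjTranspose, hUdef] at this
    exact this
  have hU'U : Uᴴ * U = 1 := by
    have := Unitary.coe_star_mul_self hh'.eigenvectorUnitary
    rw [Matrix.star_eq_conjTranspose, hUdef] at this
    exact this
  have hUent : ∀ i j, ‖U i j‖ ≤ 1 := fun i j => by
    have := entry_norm_bound_of_unitary hh'.eigenvectorUnitary.2 i j
    rwa [hUdef] at this
  have hD : Uᴴ * h * U = diagonal (fun i => ((d i : ℝ) : ℂ)) := by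
    have := hh'.conjStarAlgAut_star_eigenvectorUnitary
    rw [Unitary.conjStarAlgAut_star_apply, Matrix.star_eq_conjTranspose, hUdef, hddef, hcomp] at this
    exact this
  have hsp : h = U * diagonal (fun i => ((d i : ℝ) : ℂ)) * Uᴴ := by
    have := hh'.spectral_theorem
    rw [Unitary.conjStarAlgAut_apply, Matrix.star_eq_conjTranspose, hUdef, hddef, hcomp] at this
    exact this
  -- the flipped diagonalisation
  obtain ⟨hPP, hP'P, hPent, hPd⟩ := flip_letters
  set P : Matrix (Fin 2) (Fin 2) ℂ := !![(0 : ℂ), 1; 1, 0] with hP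
  set V : Matrix (Fin 2) (Fin 2) ℂ := U * P with hV
  have hVV : V * Vᴴ = 1 := by
    rw [hV, Matrix.conjTranspose_mul, Matrix.mul_assoc, ← Matrix.mul_assoc P, hPP, Matrix.one_mul, hUU]
  have hV'V : Vᴴ * V = 1 := by
    rw [hV, Matrix.conjTranspose_mul, Matrix.mul_assoc, ← Matrix.mul_assoc Uᴴ, hU'U, Matrix.one_mul, hP'P]
  have hVent : ∀ i j, ‖V i j‖ ≤ 1 := by
    intro i j
    fin_cases j <;> simp [hV, hP, Matrix.mul_apply, Fin.sum_univ_two] <;> exact hUent _ _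
  have hVhV : Vᴴ * h * V = Pᴴ * diagonal (fun i => ((d i : ℝ) : ℂ)) * P := by
    rw [hV, Matrix.conjTranspose_mul, ← hD]; simp only [Matrix.mul_assoc]
  -- the two decays from ★ G2
  have h00U : ((Uᴴ * h * U) 0 0).re = d 0 := by rw [hD, Matrix.diagonal_apply_eq, Complex.ofReal_re]
  have h00V : ((Vᴴ * h * V) 0 0).re = d 1 := by rw [hVhV, hPd, Complex.ofReal_re]
  have hIs : ∫ c : ℝ × ℂ × ℝ, ‖((1 : Matrix (Fin 2) (Fin 2) ℂ) + I • hermTwo c).det‖ ^ (-((a + s + (b + s)).re - e)) ≤ Iσ := by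
    have hint : ∀ {σ : ℝ}, 3 < σ → Integrable (fun c : ℝ × ℂ × ℝ => ‖((1 : Matrix (Fin 2) (Fin 2) ℂ) + I • hermTwo c).det‖ ^ (-σ)) := by
      intro σ hσ
      have := integrable_norm_det_rpow_neg_hermTwo ((1 : ℝ), (0 : ℂ), (1 : ℝ)) (diag_posData one_pos) hσ
      simpa only [hermTwo_one_zero_one] using this
    refine integral_mono (hint (by linarith)) (hint hσI) fun c => ?_
    have h1 : 1 ≤ ‖((1 : Matrix (Fin 2) (Fin 2) ℂ) + I • hermTwo c).det‖ := by
      have := mul_le_norm_det_diag (p := 1) (q := 1) one_pos one_pos c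
      rw [hermTwo_one_zero_one] at this
      linarith
    exact Real.rpow_le_rpow_of_exponent_le h1 (by linarith)
  have hbound : ∀ (W : Matrix (Fin 2) (Fin 2) ℂ), W * Wᴴ = 1 → Wᴴ * W = 1 → (∀ i j, ‖W i j‖ ≤ 1) →
      ‖∫ x : ℝ × ℂ × ℝ, (-(2 * Real.pi * I) * (Θ * hermTwo x).trace) ^ e * xiTwoIntegrand 1 h (a + s) (b + s) x‖ ≤
        C * Real.exp (-(Real.pi / 2) * |((Wᴴ * h * W) 0 0).re|) := by
    intro W hWW hW'W hWent
    rw [traceMoment_conj hWW hW'W h Θ (a + s) (b + s) e]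
    have hG2 := norm_traceMoment_le_exp_neg_entry (Θ := Wᴴ * Θ * W) (Matrix.isHermitian_conjTranspose_mul_mul W hh') e hαβ
    refine hG2.trans (mul_le_mul_of_nonneg_right ?_ (Real.exp_pos _).le)
    -- the constant on the ball
    have hS := sum_norm_conj_le hWent Θ
    have hSΘ0 : 0 ≤ SΘ := by positivity
    have t1 : (20 * Real.pi * (‖(Wᴴ * Θ * W) 0 0‖ + ‖(Wᴴ * Θ * W) 0 1‖ + ‖(Wᴴ * Θ * W) 1 0‖ + ‖(Wᴴ * Θ * W) 1 1‖)) ^ e ≤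
        (20 * Real.pi * (4 * SΘ)) ^ e :=
      pow_le_pow_left₀ (by positivity) (mul_le_mul_of_nonneg_left hS (by positivity)) e
    have t2 : (9 : ℝ) ^ |(a + s).re| ≤ (9 : ℝ) ^ A₁ := Real.rpow_le_rpow_of_exponent_le (by norm_num) hαre
    have t3 : Real.exp (2 * Real.pi * (|(a + s).im| + |(b + s).im|)) ≤ Real.exp (2 * Real.pi * A₂) :=
      Real.exp_le_exp.mpr (mul_le_mul_of_nonneg_left hαim (by positivity))
    have t4 : (9 : ℝ) ^ ((a + s + (b + s)).re - e) ≤ (9 : ℝ) ^ (σz + 2 * r) := Real.rpow_le_rpow_of_exponent_le (by norm_num) hσhi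
    have t5 : (9 : ℝ) ^ ((a + s + (b + s)).re - e) * ∫ c : ℝ × ℂ × ℝ, ‖((1 : Matrix (Fin 2) (Fin 2) ℂ) + I • hermTwo c).det‖ ^ (-((a + s + (b + s)).re - e)) ≤
        (9 : ℝ) ^ (σz + 2 * r) * Iσ :=
      mul_le_mul t4 hIs (integral_nonneg fun c => Real.rpow_nonneg (norm_nonneg _) _) (by positivity)
    calc _ ≤ (20 * Real.pi * (4 * SΘ)) ^ e * (9 : ℝ) ^ A₁ * Real.exp (2 * Real.pi * A₂) * ((9 : ℝ) ^ (σz + 2 * r) * Iσ) := by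
          refine mul_le_mul (mul_le_mul (mul_le_mul t1 t2 (by positivity) (by positivity)) t3 (by positivity) (by positivity)) t5
            (by positivity) (by positivity)
      _ = C := by rw [hC]
  have hB0 := hbound U hUU hU'U hUent
  have hB1 := hbound V hVV hV'V hVent
  rw [h00U] at hB0
  rw [h00V] at hB1
  -- geometric mean of the two decays
  have hEE : Real.exp (-(Real.pi / 2) * |d 0|) * Real.exp (-(Real.pi / 2) * |d 1|) =
      Real.exp (-(Real.pi / 4) * (|d 0| + |d 1|)) * Real.exp (-(Real.pi / 4) * (|d 0| + |d 1|)) := by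
    rw [← Real.exp_add, ← Real.exp_add]; ring_nf
  have hMM : ‖∫ x : ℝ × ℂ × ℝ, (-(2 * Real.pi * I) * (Θ * hermTwo x).trace) ^ e * xiTwoIntegrand 1 h (a + s) (b + s) x‖ *
      ‖∫ x : ℝ × ℂ × ℝ, (-(2 * Real.pi * I) * (Θ * hermTwo x).trace) ^ e * xiTwoIntegrand 1 h (a + s) (b + s) x‖ ≤
      (C * Real.exp (-(Real.pi / 4) * (|d 0| + |d 1|))) * (C * Real.exp (-(Real.pi / 4) * (|d 0| + |d 1|))) := by
    calc _ ≤ (C * Real.exp (-(Real.pi / 2) * |d 0|)) * (C * Real.exp (-(Real.pi / 2) * |d 1|)) :=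
          mul_le_mul hB0 hB1 (norm_nonneg _) (by positivity)
      _ = C * C * (Real.exp (-(Real.pi / 2) * |d 0|) * Real.exp (-(Real.pi / 2) * |d 1|)) := by ring
      _ = _ := by rw [hEE]; ring
  have hMle := nonneg_le_nonneg_of_sq_le_sq (by positivity) hMM
  -- the entry sum against the eigenvalues
  have hsum := sum_norm_le_of_spectral hUent hsp
  have hπ := mul_le_mul_of_nonneg_left hsum Real.pi_pos.le
  have hEle : Real.exp (-(Real.pi / 4) * (|d 0| + |d 1|)) ≤ Real.exp (-(Real.pi / 16 * ∑ i, ∑ j, ‖h i j‖)) :=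
    Real.exp_le_exp.mpr (by linarith only [hπ])
  exact hMle.trans (mul_le_mul_of_nonneg_left hEle hC0)

/-- **THE SAME LETTER WITH THE `Matrix.IsHermitian` BINDER** (byte-twin of (G5)'s `hG4` hypothesis in ★ `K2LiuHermTwoXiJetContinuationGrowth.hJet_holds_growth`;
`Matrix.IsHermitian h` is by definition `hᴴ = h`). [cite: Shimura1982, §4] -/
theorem traceMoment_decay' (Θ : Matrix (Fin 2) (Fin 2) ℂ) :
    ∀ (e : ℕ) (a b z : ℂ), 3 + (e : ℝ) < (a + b + 2 * z).re →
      ∃ C c r : ℝ, 0 ≤ C ∧ 0 < c ∧ 0 < r ∧ ∀ h : Matrix (Fin 2) (Fin 2) ℂ, h.IsHermitian → h.det.re < 0 →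
        ∀ s : ℂ, dist s z < r →
          ‖∫ x : ℝ × ℂ × ℝ, (-(2 * Real.pi * I) * (Θ * hermTwo x).trace) ^ e * xiTwoIntegrand 1 h (a + s) (b + s) x‖ ≤
            C * Real.exp (-(c * ∑ i, ∑ j, ‖h i j‖)) :=
  traceMoment_decay Θ

end Summit.HodgeConjecture.HodgeConjecture.Cruxes.HLiu418.K2LiuHermTwoXiMomentDecay

end
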